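/-
Copyright: statement-level skeleton of a published paper (lit-balaban cell, Phase-2 proof seat p26). No proof claims beyond what
the kernel checks below.
-/
import Literature.MathematicalPhysics.QuantumFieldTheory.Balaban1983to89.B3Eq37Pictures
import Literature.MathematicalPhysics.QuantumFieldTheory.Balaban1983to89.B3Sect1Graphs122
import Literature.MathematicalPhysics.QuantumFieldTheory.Balaban1983to89.B3Sect1TwoPoint
import Literature.MathematicalPhysics.QuantumFieldTheory.Balaban1983to89.B3Eq131Example
import Literature.MathematicalPhysics.QuantumFieldTheory.Balaban1983to89.B1RG242Torus

/-!
# `Balaban1983to89.B3Eq123Counterterms` — T. Bałaban, *(Higgs)₂,₃ quantum fields in a finite volume. III. Renormalization*,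
Commun. Math. Phys. **88** (1983) 411–445 [Balaban1983Higgs3], Sect. 1 pp. 416–417: the displayed terms of the scalar self-energy
**(1.22)** and the mass counterterms **(1.23)** they define, AS ANALYTIC EXPRESSIONS on the ε-lattice, with the printed
bookkeeping sentences proved and the dictionary to the drawn pictures

statement-level skeleton of published theorems with citation tags; proofs where landed; nothing here is a claim about the
Yang–Mills mass gap

PDF held: `paper:balaban1983-higgs-2-3-quantum-fields-finite-volume` (journal page = PDF page + 410).  The displays (1.22) p. 416
and (1.23) p. 417 were READ AS IMAGES on the ×2 renders
`run/shared/lean/pub/pub-balaban/b2b-balaban-ref1/pages/1983-cmp88-higgs23-III/1983-cmp88-higgs23-III-p006-x2.png` (p. 416) and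
`…-p007-x2.png` (p. 417); the OCR layer of these two displays is unusable and was not used.

CITATION HEADER (lean-in-tree rule).  lit-balaban MEGA-FORMALIZATION (HOME `run/shared/lean/pub/lit-balaban/`), Phase 2, seat
**p26 gen 39** (unit `lit-balaban-p26-g39`), free-target protocol G.5-34(d) (TAKING HOME/STATUS.md 2026-08-23T06:30:58Z; the
class «§1 displays AS ANALYTIC EXPRESSIONS» opened by the typer g29 on the B3-CLOSURE §3(a) rows, `B3Eq18VertexExpansion`
p354294).  ROWS **B3.Eq1.23** and the (1.22) cell of **B3.Eq1.19-1.22** of `HOME/lit-balaban-r15/ROWS-B3.md` (fold owner r15).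
What the tree had before this file, verbatim from the headers of the files of record: r15 `B3Sect1TwoPoint` — *"(1.22) (the first
terms of Σ^ε, an open-ended display "+ …" with pictures) is NOT typed"*, *"the displayed list (1.23) of the nine lowest counterterm
graphs ("+ …") is NOT reproduced"*; p18 `B3Sect1Graphs122` (the pictures of (1.22)/(1.23) as graphs of the model, degrees and
orders) — *"NOT here: the analytic expressions (propagators C^ε_0, C^ε, the constants)"*; r15 `B3Eq131Example.basicCT` = the
fourth counterterm of (1.23) alone (the worked example (1.31)).

REUSED, nothing re-declared: r15's kernel vocabulary `B3Sect3ScalarSelfEnergy.Kernel`/`kernelOp`/`dKernel` (kernel of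
∂_μ∘G∘∂*_μ)/`d1Kernel` (kernel of ∂_μ∘G) and `B3Sect3VectorSelfEnergy.dAdjKernel` (kernel of G∘∂*_μ); r15's (1.23) bookkeeping
`B3Sect1TwoPoint.dm2Graph` (δm²_G := Σ_{x′} ε^dΣ^ε_G(x,x′)), `idx123`, `dm2Coeff`; r15's `B3Eq131Example.basicCT`; this lineage's
`B3Eq37Pictures.LocPicture`/`LocPicture.amp`/`pic36a`/`pic37a`/`amp_pic36a`/`amp_pic37a_resummed`/`kernel2`; p18's graphs
`B3Sect3LowestOrderGraphs.g36a/b/c`, `B3Sect3Graphs318.g318a/b/g`, `B3Sect1Graphs122.g122g/g123g/g123h/g123i`; r05's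
`Site.const_of_shift_invariant` (`B1RG242Torus`).

THE PRINTED TEXT.  p. 416 [PDF 6], verbatim: *"We have η = ε (hence L^kε = 1) and the only vertices are (1.6), (1.7) [with δm²
instead of δm²_k(x)], (1.8), and (1.10) with n′ = 0, B̃ = 0, g_k = 1 (but without any restrictions on n). The propagators are C^ε_0
for the scalar field and C^ε = (−Δ^ε + μ₀²)^{−1} for the vector field (of course internal indices and vector indices are understood
here). Let us write a few terms of the expansion of Σ^ε:
Σ^ε(x−x′) = −4(N+2)λC^ε_0(0)δ^ε(x−x′) + e²dC^ε(0)q²δ^ε(x−x′) + (2·3/4!)de⁴ε²(C^ε(0))²q⁴δ^ε(x−x′)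
 − e²Σ_{μ=1}^d q(∂^ε_μC^ε_0∂^{ε*}_μ)(x−x′)qC^ε(x−x′) + 2de⁴q²C^ε_0(x−x′)q²(C^ε(x−x′))² + 4²(2N+4)λ²(C^ε_0(x−x′))³
 + e²Σ_{μ=1}^dΣ_{x″∈T_ε} ε^dq(∂^ε_μC^ε_0)(x−x″)δm²(C^ε_0∂^{ε*}_μ)(x″−x′)qC^ε(x−x′) + … = [seven pictures] + ⋯ (1.22)
Here we did not write, and we will not write in the future, combinatoric factors before the graphs, understanding that they are a
part of the graphical description."*  p. 417 [PDF 7], verbatim: *"we define δm²_G by the equation −δm²_G + Σ_{x∈T_ε} ε^dΣ^ε_G(x) = 0.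
… If a graph G representing Σ^ε_G(x−x′) has the external legs localized in x, x′, then δm²_G = Σ_{x′∈T_ε} ε^dΣ^ε_G(x−x′) will be
represented by the same graph G but with both external legs localized in x and with the summation over x′. For example the
expressions in (1.22) define the following counterterms:
δm² = −4(N+2)λC^ε_0(0) + e²dC^ε(0)q² + (2·3/4!)de⁴ε²(C^ε(0))²q⁴ − e²Σ_{x′∈T_ε} ε^dΣ_{μ=1}^d q(∂^ε_μC^ε_0∂^{ε*}_μ)(x−x′)qC^ε(x−x′)
 + 2de⁴Σ_{x′∈T_ε} ε^dq²C^ε_0(x−x′)q²(C^ε(x−x′))² + 4²(2N+4)λ²Σ_{x′∈T_ε} ε^d(C^ε_0(x−x′))³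
 + e²Σ_{x′,x″∈T_ε} ε^{2d}Σ_{μ=1}^d q(∂^ε_μC^ε_0)(x−x″)δm²₁(C^ε_0∂^{ε*}_μ)(x″−x′)qC^ε(x−x′) + … = [nine pictures] + ⋯ (1.23)
where δm²₁ denote a sum of terms δm²_{(α,β)} of the order α + 2β = 2. Thus we have determined the counterterm δm²."*

WHAT IS TYPED / PROVED (everything kernel-checked; «+ …» is never closed: the objects below are THE DISPLAYED PARTS).
* §1 the data: `SEData` (ε, e, λ, N, the charge factor, the two free propagators C^ε_0, C^ε as supplied two-point kernels), the
  lattice delta `delta` (δ^ε(x−x′) = ε^{−d}·𝟙{x = x′}, `dm2Graph_mul_delta`: Σ_{x′}ε^d f(x)δ^ε(x−x′) = f(x)).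
* §2 **(1.22)**: the seven displayed terms `sig1` … `sig7` of Σ^ε as two-point kernels (defs with bodies, printed factors
  verbatim; ⑦ with the mass-renormalization vertex (1.7) carrying a site function `dm2` at its position x″ — print: δm²), and
  their sum `sigma122`.
* §3 **(1.23)**: `ctk D := dm2Graph ε^d (sigk D)` — print's rule applied to each term — and, PROVED, the displayed closed forms
  (`ct1_eq` … `ct7_eq`: the δ^ε collapses in ①②③, the sums over x′ (x′, x″) stay in ④⑤⑥ (⑦)); **`ct4_eq_basicCT`**: the fourth
  counterterm IS r15's `basicCT` of (1.31) at (L^kε)² = 1; `dm2One` := ① + ② + ④ (print's δm²₁, the order α+2β = 2 terms) and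
  `dm2_123` := the displayed part of (1.23) with δm²₁ inserted in the last term; **`eq123_of_122`**: print's sentence *"the
  expressions in (1.22) define the following counterterms"* — `dm2Graph ε^d (sigma122 D (dm2One D)) = dm2_123 D`; **`solves_123`**:
  the displayed counterterms SOLVE print's defining equations −δm²_G + Σ_{x′}ε^dΣ^ε_G(x, x′) = 0 graph by graph.
* §4 the ORDER bookkeeping behind *"This equation can be solved recursively if δm² and Σ^ε are expanded into power series in e, λ
  … δm² will be defined by the terms of order ≦ 4 … δm²₁ … of the order α + 2β = 2"*: under the weight-(1,2) scaling
  (e, λ) ↦ (se, s²λ) (`SEData.scale`) the terms ①②④ scale by s², ③⑤⑥ by s⁴, ⑦ by s²·(weight of its δm²) (`sigk_scale`,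
  `ctk_scale`); `dm2One_scale` (δm²₁ is homogeneous of weight 2) and **`dm2_123_scale`** (the displayed δm² = s²·δm²₁ +
  s⁴·(③+⑤+⑥+⑦(δm²₁)): δm²₁ is EXACTLY its weight-2 part, `dm2Two` the weight-4 part); **`recursion_order_four`** — THE RECURSION:
  inserting the graded ansatz s²·δm²₁ + s⁴·δm²₂ at the vertex (1.7) of the (scaled) displayed Σ^ε and applying print's rule returns
  the ansatz exactly through order 4 (the weight-2 output involves no inserted counterterm — triangularity, the only δm²-carrying
  term ⑦ starting at e² —, the weight-4 output only δm²₁), the sole discrepancy being s⁶·⑦(δm²₂) beyond the truncation; at the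
  level of r15's coefficients δm²_{(α,β)}: **`idx123_filter_le_two`** / **`truncation_last_term`** / `truncation_dm2Of123` (of
  e²·Σ_{2≦α+2β≦4}e^αλ^βδm²_{(α,β)} = e²·`dm2Of123` only (α,β) ∈ {(2,0),(0,1)} survive the order-≦4 truncation: e²·δm² ↦ e²·δm²₁).
* §5 **the three last pictures ⑦⑧⑨ of (1.23)** = the last term with δm²₁ split into its three graphs: `sig7_add`/`ct7_add` and
  **`ct7_dm2One`** (`ct7 D (dm2One D) = ct7 D (ct1 D) + ct7 D (ct2 D) + ct7 D (ct4 D)`).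
* §6 x-INDEPENDENCE: print writes every propagator as a function of x − x′; for shift-invariant kernels C^ε_0, C^ε (`ShiftInv`) every
  counterterm of (1.23) is a constant on T_ε (`ct1_const` … `ct7_const`, via r05's `Site.const_of_shift_invariant`), as print's δm²
  is a number.
* §7 THE PICTURES as localized drawn objects: `ctPicture G v` = p18's graph `G` with every EXTERNAL leg localized at the vertex
  `v` (print p. 417: *"the same graph G but with both external legs localized in x"*); `pics122` = the seven pictures of (1.22)
  (natural localization; = `pic36c`, `pic36b`, –, `pic36a`, … by `rfl`), `pics123` = the nine of (1.23); **`ctPicture_g36a`**: the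
  fourth picture of (1.23) IS this lineage's `pic37a` ((3.7)₁); `ctPicture_oneVertex`: for a one-vertex graph the counterterm
  picture is the graph itself (①②③ of (1.23) are drawn exactly as in (1.22)).
* §8 DICTIONARY picture ↦ expression through `LocPicture.amp`: **`amp_pic122_4`**/**`amp_pic123_4`** (④: the natural picture
  with the kernel `sig4` on its lines is the two-point insertion Σ_{x,x′}ε^{2d}φ(x)Σ₄(x,x′)φ′(x′); the counterterm picture is the
  mass insertion Σ_xε^dφ(x)·ct4(x)·φ′(x)), the same for ⑤, ⑥ (`amp_pic122_5/6`, `amp_pic123_5/6`), the one-vertex ①②③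
  (`amp_pic122_oneVertex`), and ⑦ with its three vertices (`amp_pic122_7`).
TRANSCRIPT NOTES.  T1 (as in r15's `B3Eq131Example`/`B3Sect3TriangleGraphs`): internal indices suppressed — the charge matrices
q…q of a term are carried as ONE real factor `q2` (q⁴ and q²…q² as `q2 ^ 2`), the propagators as real two-point kernels; print:
*"internal indices and vector indices are understood here"*.  T2: the factor `d` of ②③⑤ is the dimension `P.d` of the torus
(the trace over the vector index of the A-tadpole / of (C^ε)²).  T3: print writes C^ε_0, C^ε as functions of x − x′ on T_ε
(one-variable kernels); the definitions take two-point kernels (r15's T3 convention of `B3Eq131Example`, so that `basicCT` is matched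
by name), the printed case being the shift-invariant kernels of §6 (`ShiftInv`: K(x+e_μ, x′+e_μ) = K(x, x′) for every unit vector,
which on the torus is «K depends on x − x′ only»), under which every x-dependence statement is proved; C^ε_0(0), C^ε(0) ↦ the
diagonal values C0 x x, C x x at the vertex.  T4: the
combinatoric factors are print's (p. 416: part of the graphical description); nothing is asserted about their derivation from Wick's
theorem, nor about the «+ …», 1PI-ness, or the convergence sentence *"the expressions in (1.22) are divergent as ε → 0 (except
the third)"* (degree level: p18 `pictures122_deg_three`).  0 sorry, 0 new `Prop` facts.
Unit `lit-balaban-p26` gen 39 (literature-prover-lit-balaban-p26-g39-0), 2026-08-23.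
-/

open scoped BigOperators RealInnerProductSpace
open Finset

namespace Literature.MathematicalPhysics.QuantumFieldTheory.Balaban1983to89.B3Eq123Counterterms

open LatticeFieldCalculus B3Sect3ScalarSelfEnergy B3Sect3VectorSelfEnergy B3Sect1TwoPoint

noncomputable section

/-! ## §1 The data of (1.22): couplings, charge factor, the two free propagators; the lattice δ -/

section Data

variable {P : Params} {j : ℕ}

/-- The letters of (1.22)/(1.23) p. 416: the lattice spacing `ε`, the couplings `e`, `λ`, the number `N` of real scalar
components, the charge factor `q2` (T1: the matrices q…q as one real factor), and the free propagators *"C^ε_0 for the scalar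
field and C^ε = (−Δ^ε + μ₀²)^{−1} for the vector field"* as supplied two-point kernels on the torus.
[cite: Balaban1983Higgs3, (1.22) p.416] -/
structure SEData (P : Params) (j : ℕ) where
  /-- lattice spacing ε -/
  ε : ℝ
  /-- gauge coupling e -/
  e : ℝ
  /-- quartic coupling λ -/
  lam : ℝ
  /-- number of real components of the scalar field -/
  N : ℕ
  /-- the charge factor q…q (T1) -/
  q2 : ℝ
  /-- the scalar free propagator C^ε_0 = (−Δ^ε_0 + m²)^{−1} (kernel) -/
  C0 : Kernel P j
  /-- the vector free propagator C^ε = (−Δ^ε + μ₀²)^{−1} (kernel) -/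
  C : Kernel P j

namespace SEData

variable (D : SEData P j)

/-- the volume element ε^d of the sums over T_ε. [cite: Balaban1983Higgs3, (1.23) p.417] -/
def w : ℝ := D.ε ^ P.d

/-- the difference-quotient factor ε^{−1} of ∂^ε_μ. [cite: Balaban1983Higgs3, (1.22) p.416] -/
def c : ℝ := D.ε⁻¹

/-- The weight-(1,2) scaling of the couplings, (e, λ) ↦ (s·e, s²·λ): a term of order e^αλ^β picks up s^{α+2β} — the
bookkeeping of *"terms of order α + 2β"* p. 417. [cite: Balaban1983Higgs3, (1.23) p.417] -/
def scale (s : ℝ) : SEData P j := { D with e := s * D.e, lam := s ^ 2 * D.lam }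

/-- the scaling keeps ε. [cite: Balaban1983Higgs3, (1.23) p.417] -/
@[simp] theorem scale_ε (s : ℝ) : (D.scale s).ε = D.ε := rfl
/-- the scaling multiplies e by s. [cite: Balaban1983Higgs3, (1.23) p.417] -/
@[simp] theorem scale_e (s : ℝ) : (D.scale s).e = s * D.e := rfl
/-- the scaling multiplies λ by s². [cite: Balaban1983Higgs3, (1.23) p.417] -/
@[simp] theorem scale_lam (s : ℝ) : (D.scale s).lam = s ^ 2 * D.lam := rfl
/-- the scaling keeps N. [cite: Balaban1983Higgs3, (1.23) p.417] -/
@[simp] theorem scale_N (s : ℝ) : (D.scale s).N = D.N := rfl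
/-- the scaling keeps the charge factor. [cite: Balaban1983Higgs3, (1.23) p.417] -/
@[simp] theorem scale_q2 (s : ℝ) : (D.scale s).q2 = D.q2 := rfl
/-- the scaling keeps C^ε_0. [cite: Balaban1983Higgs3, (1.23) p.417] -/
@[simp] theorem scale_C0 (s : ℝ) : (D.scale s).C0 = D.C0 := rfl
/-- the scaling keeps C^ε. [cite: Balaban1983Higgs3, (1.23) p.417] -/
@[simp] theorem scale_C (s : ℝ) : (D.scale s).C = D.C := rfl
/-- the scaling keeps the volume element. [cite: Balaban1983Higgs3, (1.23) p.417] -/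
@[simp] theorem scale_w (s : ℝ) : (D.scale s).w = D.w := rfl
/-- the scaling keeps the difference-quotient factor. [cite: Balaban1983Higgs3, (1.23) p.417] -/
@[simp] theorem scale_c (s : ℝ) : (D.scale s).c = D.c := rfl

end SEData

/-- The lattice delta δ^ε(x − x′) = ε^{−d}·𝟙{x = x′} of (1.22) (the kernel of the identity with respect to the volume element
`w` = ε^d). [cite: Balaban1983Higgs3, (1.22) p.416] -/
def delta (w : ℝ) : Kernel P j := fun x x' => if x = x' then w⁻¹ else 0

/-- kernel: r15's `dm2Graph` is additive in the kernel. [cite: Balaban1983Higgs3, (1.23) p.417] -/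
theorem dm2Graph_add (w : ℝ) (K K' : Kernel P j) (x : Site P j) :
    dm2Graph w (K + K') x = dm2Graph w K x + dm2Graph w K' x := by
  simp only [dm2Graph, Pi.add_apply, mul_add, Finset.sum_add_distrib]

/-- kernel: a constant factor comes out of `dm2Graph`. [cite: Balaban1983Higgs3, (1.23) p.417] -/
theorem dm2Graph_const_mul (w a : ℝ) (K : Kernel P j) (x : Site P j) :
    dm2Graph w (fun y y' => a * K y y') x = a * dm2Graph w K x := by
  simp only [dm2Graph, Finset.mul_sum]
  exact Finset.sum_congr rfl fun _ _ => by ring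

/-- kernel: `dm2Graph` depends only on the row `K x ·`. [cite: Balaban1983Higgs3, (1.23) p.417] -/
theorem dm2Graph_congr (w : ℝ) {K K' : Kernel P j} {x : Site P j} (h : ∀ x', K x x' = K' x x') :
    dm2Graph w K x = dm2Graph w K' x := by
  simp only [dm2Graph]
  exact Finset.sum_congr rfl fun x' _ => by rw [h x']

/-- **The δ^ε collapses the sum over x′**: Σ_{x′∈T_ε} ε^d f(x)δ^ε(x − x′) = f(x) (ε^d ≠ 0) — why the first three counterterms
of (1.23) carry no sum. [cite: Balaban1983Higgs3, (1.23) p.417] -/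
theorem dm2Graph_mul_delta {w : ℝ} (hw : w ≠ 0) (f : Site P j → ℝ) (x : Site P j) :
    dm2Graph w (fun y y' => f y * delta w y y') x = f x := by
  simp only [dm2Graph, delta, mul_ite, mul_zero, Finset.sum_ite_eq, Finset.mem_univ, if_true]
  field_simp

end Data

/-! ## §2 (1.22): the seven displayed terms of the scalar self-energy Σ^ε as two-point kernels -/

section Sigma122

variable {P : Params} {j : ℕ} (D : SEData P j)

/-- **(1.22)①** p. 416: `−4(N+2)λC^ε_0(0)δ^ε(x−x′)` — the φ-tadpole at the vertex (1.6) (C^ε_0(0) = the diagonal value of the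
scalar propagator at the vertex, T3). [cite: Balaban1983Higgs3, (1.22) p.416] -/
def sig1 : Kernel P j := fun x x' => -4 * ((D.N : ℝ) + 2) * D.lam * D.C0 x x * delta D.w x x'

/-- **(1.22)②** p. 416: `e²dC^ε(0)q²δ^ε(x−x′)` — the A-tadpole at the vertex (1.10)_{2,0} (T2: d = the dimension).
[cite: Balaban1983Higgs3, (1.22) p.416] -/
def sig2 : Kernel P j := fun x x' => D.e ^ 2 * (P.d : ℝ) * D.C x x * D.q2 * delta D.w x x'

/-- **(1.22)③** p. 416: `(2·3/4!)de⁴ε²(C^ε(0))²q⁴δ^ε(x−x′)` — two A-tadpoles at the vertex (1.10)_{4,0} (q⁴ = (q²)², T1).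
[cite: Balaban1983Higgs3, (1.22) p.416] -/
def sig3 : Kernel P j := fun x x' =>
  (2 * 3 : ℝ) / (Nat.factorial 4 : ℕ) * (P.d : ℝ) * D.e ^ 4 * D.ε ^ 2 * (D.C x x) ^ 2 * D.q2 ^ 2 * delta D.w x x'

/-- **(1.22)④** p. 416: `−e²Σ_{μ=1}^d q(∂^ε_μC^ε_0∂^{ε*}_μ)(x−x′)qC^ε(x−x′)` — two vertices (1.8)_{1,0} joined by the doubly
differentiated φ-line and the A-line (r15's `dKernel` = the kernel of ∂_μ∘C₀∘∂*_μ). [cite: Balaban1983Higgs3, (1.22) p.416] -/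
def sig4 : Kernel P j := fun x x' => -(D.e ^ 2) * ∑ μ : Fin P.d, D.q2 * dKernel D.c μ D.C0 x x' * D.C x x'

/-- **(1.22)⑤** p. 416: `2de⁴q²C^ε_0(x−x′)q²(C^ε(x−x′))²` — two vertices (1.10)_{2,0} joined by the φ-line and both A-lines.
[cite: Balaban1983Higgs3, (1.22) p.416] -/
def sig5 : Kernel P j := fun x x' => 2 * (P.d : ℝ) * D.e ^ 4 * D.q2 * D.C0 x x' * D.q2 * (D.C x x') ^ 2

/-- **(1.22)⑥** p. 416: `4²(2N+4)λ²(C^ε_0(x−x′))³` — the sunset of two vertices (1.6). [cite: Balaban1983Higgs3, (1.22) p.416] -/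
def sig6 : Kernel P j := fun x x' => (4 : ℝ) ^ 2 * (2 * (D.N : ℝ) + 4) * D.lam ^ 2 * (D.C0 x x') ^ 3

/-- **(1.22)⑦** p. 416: `e²Σ_{μ=1}^dΣ_{x″∈T_ε} ε^dq(∂^ε_μC^ε_0)(x−x″)δm²(C^ε_0∂^{ε*}_μ)(x″−x′)qC^ε(x−x′)` — the graph ④ with a mass
renormalization vertex (1.7) on its φ-line at x″; the inserted counterterm is the site function `dm2` evaluated at x″ (print:
the number δm²; in (1.23) the number δm²₁) (r15's `d1Kernel` = kernel of ∂_μ∘C₀, `dAdjKernel` = kernel of C₀∘∂*_μ).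
[cite: Balaban1983Higgs3, (1.22) p.416] -/
def sig7 (dm2 : Site P j → ℝ) : Kernel P j := fun x x' =>
  D.e ^ 2 * ∑ μ : Fin P.d, ∑ x'' : Site P j,
    D.w * D.q2 * d1Kernel D.c μ D.C0 x x'' * dm2 x'' * dAdjKernel D.c μ D.C0 x'' x' * D.C x x'

/-- **(1.22)** p. 416 [PDF 6], THE DISPLAYED PART: Σ^ε(x−x′) = ① + ② + ③ + ④ + ⑤ + ⑥ + ⑦ (+ …, not closed), the vertex (1.7) of ⑦
carrying `dm2`. [cite: Balaban1983Higgs3, (1.22) p.416] -/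
def sigma122 (dm2 : Site P j → ℝ) : Kernel P j :=
  sig1 D + sig2 D + sig3 D + sig4 D + sig5 D + sig6 D + sig7 D dm2

/-- ⑦ is additive in the inserted counterterm (the vertex (1.7) is linear in δm²). [cite: Balaban1983Higgs3, (1.22) p.416] -/
theorem sig7_add (f g : Site P j → ℝ) : sig7 D (f + g) = sig7 D f + sig7 D g := by
  funext x x'
  simp only [sig7, Pi.add_apply, ← mul_add, ← Finset.sum_add_distrib]
  congr 1
  refine Finset.sum_congr rfl fun μ _ => Finset.sum_congr rfl fun x'' _ => ?_
  ring

/-- ⑦ is homogeneous in the inserted counterterm. [cite: Balaban1983Higgs3, (1.22) p.416] -/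
theorem sig7_const_mul (a : ℝ) (f : Site P j → ℝ) : sig7 D (fun y => a * f y) = fun x x' => a * sig7 D f x x' := by
  funext x x'
  simp only [sig7, Finset.mul_sum]
  exact Finset.sum_congr rfl fun μ _ => Finset.sum_congr rfl fun x'' _ => by ring

end Sigma122

/-! ## §3 (1.23): the counterterms the seven terms define, print's rule `dm2Graph` applied term by term -/

section Eq123

variable {P : Params} {j : ℕ} (D : SEData P j)

/-- **(1.23)①**: δm²_G for G = ①, i.e. Σ_{x′}ε^d·①(x,x′). [cite: Balaban1983Higgs3, (1.23) p.417] -/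
def ct1 (x : Site P j) : ℝ := dm2Graph D.w (sig1 D) x
/-- **(1.23)②**. [cite: Balaban1983Higgs3, (1.23) p.417] -/
def ct2 (x : Site P j) : ℝ := dm2Graph D.w (sig2 D) x
/-- **(1.23)③**. [cite: Balaban1983Higgs3, (1.23) p.417] -/
def ct3 (x : Site P j) : ℝ := dm2Graph D.w (sig3 D) x
/-- **(1.23)④**. [cite: Balaban1983Higgs3, (1.23) p.417] -/
def ct4 (x : Site P j) : ℝ := dm2Graph D.w (sig4 D) x
/-- **(1.23)⑤**. [cite: Balaban1983Higgs3, (1.23) p.417] -/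
def ct5 (x : Site P j) : ℝ := dm2Graph D.w (sig5 D) x
/-- **(1.23)⑥**. [cite: Balaban1983Higgs3, (1.23) p.417] -/
def ct6 (x : Site P j) : ℝ := dm2Graph D.w (sig6 D) x
/-- **(1.23)⑦** with the inserted counterterm `dm2` (print: δm²₁). [cite: Balaban1983Higgs3, (1.23) p.417] -/
def ct7 (dm2 : Site P j → ℝ) (x : Site P j) : ℝ := dm2Graph D.w (sig7 D dm2) x

/-- **(1.23)① as displayed**: `−4(N+2)λC^ε_0(0)` — no sum over x′ (the δ^ε collapsed it; ε ≠ 0).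
[cite: Balaban1983Higgs3, (1.23) p.417] -/
theorem ct1_eq (hε : D.ε ≠ 0) (x : Site P j) : ct1 D x = -4 * ((D.N : ℝ) + 2) * D.lam * D.C0 x x := by
  unfold ct1 sig1
  exact dm2Graph_mul_delta (pow_ne_zero _ hε) (fun y => -4 * ((D.N : ℝ) + 2) * D.lam * D.C0 y y) x

/-- **(1.23)② as displayed**: `e²dC^ε(0)q²`. [cite: Balaban1983Higgs3, (1.23) p.417] -/
theorem ct2_eq (hε : D.ε ≠ 0) (x : Site P j) : ct2 D x = D.e ^ 2 * (P.d : ℝ) * D.C x x * D.q2 := by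
  unfold ct2 sig2
  exact dm2Graph_mul_delta (pow_ne_zero _ hε) (fun y => D.e ^ 2 * (P.d : ℝ) * D.C y y * D.q2) x

/-- **(1.23)③ as displayed**: `(2·3/4!)de⁴ε²(C^ε(0))²q⁴`. [cite: Balaban1983Higgs3, (1.23) p.417] -/
theorem ct3_eq (hε : D.ε ≠ 0) (x : Site P j) :
    ct3 D x = (2 * 3 : ℝ) / (Nat.factorial 4 : ℕ) * (P.d : ℝ) * D.e ^ 4 * D.ε ^ 2 * (D.C x x) ^ 2 * D.q2 ^ 2 := by
  unfold ct3 sig3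
  exact dm2Graph_mul_delta (pow_ne_zero _ hε)
    (fun y => (2 * 3 : ℝ) / (Nat.factorial 4 : ℕ) * (P.d : ℝ) * D.e ^ 4 * D.ε ^ 2 * (D.C y y) ^ 2 * D.q2 ^ 2) x

/-- the printed numerical factor of ③: 2·3/4! = 1/4. [cite: Balaban1983Higgs3, (1.22) p.416] -/
theorem factor_sig3 : (2 * 3 : ℝ) / (Nat.factorial 4 : ℕ) = 1 / 4 := by
  norm_num [Nat.factorial]

/-- **(1.23)④ as displayed**: `−e²Σ_{x′∈T_ε} ε^dΣ_{μ=1}^d q(∂^ε_μC^ε_0∂^{ε*}_μ)(x−x′)qC^ε(x−x′)`.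
[cite: Balaban1983Higgs3, (1.23) p.417] -/
theorem ct4_eq (x : Site P j) :
    ct4 D x = -(D.e ^ 2) * ∑ x' : Site P j, D.w * ∑ μ : Fin P.d, D.q2 * dKernel D.c μ D.C0 x x' * D.C x x' := by
  simp only [ct4, sig4, dm2Graph, Finset.mul_sum]
  exact Finset.sum_congr rfl fun x' _ => Finset.sum_congr rfl fun μ _ => by ring

/-- **(1.23)④ IS r15's basic counterterm of (1.31)** (`B3Eq131Example.basicCT`, volume element ε^d, difference quotient ε^{−1},
the factor (L^kε)² = 1: p. 416 *"hence L^kε = 1"*). [cite: Balaban1983Higgs3, (1.31) p.419] -/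
theorem ct4_eq_basicCT (x : Site P j) : ct4 D x = B3Eq131Example.basicCT D.w D.c D.e D.q2 1 D.C0 D.C x := by
  rw [ct4_eq, B3Eq131Example.basicCT]
  congr 1
  refine Finset.sum_congr rfl fun x' _ => ?_
  rw [Finset.mul_sum, Finset.mul_sum]
  exact Finset.sum_congr rfl fun μ _ => by ring

/-- **(1.23)⑤ as displayed**: `2de⁴Σ_{x′∈T_ε} ε^dq²C^ε_0(x−x′)q²(C^ε(x−x′))²`. [cite: Balaban1983Higgs3, (1.23) p.417] -/
theorem ct5_eq (x : Site P j) :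
    ct5 D x = 2 * (P.d : ℝ) * D.e ^ 4 * ∑ x' : Site P j, D.w * (D.q2 * D.C0 x x' * D.q2 * (D.C x x') ^ 2) := by
  simp only [ct5, sig5, dm2Graph, Finset.mul_sum]
  exact Finset.sum_congr rfl fun x' _ => by ring

/-- **(1.23)⑥ as displayed**: `4²(2N+4)λ²Σ_{x′∈T_ε} ε^d(C^ε_0(x−x′))³`. [cite: Balaban1983Higgs3, (1.23) p.417] -/
theorem ct6_eq (x : Site P j) :
    ct6 D x = (4 : ℝ) ^ 2 * (2 * (D.N : ℝ) + 4) * D.lam ^ 2 * ∑ x' : Site P j, D.w * (D.C0 x x') ^ 3 := by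
  simp only [ct6, sig6, dm2Graph, Finset.mul_sum]
  exact Finset.sum_congr rfl fun x' _ => by ring

/-- **(1.23)⑦ as displayed**: `e²Σ_{x′,x″∈T_ε} ε^{2d}Σ_{μ=1}^d q(∂^ε_μC^ε_0)(x−x″)δm²₁(C^ε_0∂^{ε*}_μ)(x″−x′)qC^ε(x−x′)` (with the
inserted counterterm `dm2`; print: δm²₁ = `dm2One`). [cite: Balaban1983Higgs3, (1.23) p.417] -/
theorem ct7_eq (dm2 : Site P j → ℝ) (x : Site P j) :
    ct7 D dm2 x = D.e ^ 2 * ∑ x' : Site P j, ∑ x'' : Site P j, D.w ^ 2 * ∑ μ : Fin P.d,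
      D.q2 * d1Kernel D.c μ D.C0 x x'' * dm2 x'' * dAdjKernel D.c μ D.C0 x'' x' * D.C x x' := by
  simp only [ct7, sig7, dm2Graph, Finset.mul_sum]
  refine Finset.sum_congr rfl fun x' _ => ?_
  rw [Finset.sum_comm]
  exact Finset.sum_congr rfl fun x'' _ => Finset.sum_congr rfl fun μ _ => by ring

/-- ⑦'s counterterm is additive in the inserted counterterm. [cite: Balaban1983Higgs3, (1.23) p.417] -/
theorem ct7_add (f g : Site P j → ℝ) (x : Site P j) : ct7 D (f + g) x = ct7 D f x + ct7 D g x := by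
  simp only [ct7, sig7_add, dm2Graph_add]

/-- ⑦'s counterterm is homogeneous in the inserted counterterm. [cite: Balaban1983Higgs3, (1.23) p.417] -/
theorem ct7_const_mul (a : ℝ) (f : Site P j → ℝ) (x : Site P j) :
    ct7 D (fun y => a * f y) x = a * ct7 D f x := by
  simp only [ct7, sig7_const_mul, dm2Graph_const_mul]

/-- **δm²₁** p. 417, verbatim: *"where δm²₁ denote a sum of terms δm²_{(α,β)} of the order α + 2β = 2"* — of the displayed
counterterms these are ① (λ: (α,β) = (0,1)), ② and ④ (e²: (2,0)); §4 proves that this is exactly the weight-2 part.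
[cite: Balaban1983Higgs3, (1.23) p.417] -/
def dm2One (x : Site P j) : ℝ := ct1 D x + ct2 D x + ct4 D x

/-- **(1.23)** p. 417 [PDF 7], THE DISPLAYED PART: δm² = ① + ② + ③ + ④ + ⑤ + ⑥ + ⑦(δm²₁) (+ …, not closed).
[cite: Balaban1983Higgs3, (1.23) p.417] -/
def dm2_123 (x : Site P j) : ℝ :=
  ct1 D x + ct2 D x + ct3 D x + ct4 D x + ct5 D x + ct6 D x + ct7 D (dm2One D) x

/-- **p. 417, the sentence before (1.23)**, verbatim: *"For example the expressions in (1.22) define the following counterterms"* —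
PROVED: print's rule δm²_G = Σ_{x′∈T_ε} ε^dΣ^ε_G(x − x′) (r15's `dm2Graph`) applied to the displayed part of Σ^ε (1.22), with δm²₁ at
the vertex (1.7) of the last term, IS the displayed part of (1.23). [cite: Balaban1983Higgs3, (1.23) p.417] -/
theorem eq123_of_122 (x : Site P j) : dm2Graph D.w (sigma122 D (dm2One D)) x = dm2_123 D x := by
  simp only [sigma122, dm2Graph_add, dm2_123, ct1, ct2, ct3, ct4, ct5, ct6, ct7]

/-- **The displayed counterterms SOLVE print's defining equations graph by graph** (p. 417, verbatim: *"we define δm²_G by the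
equation −δm²_G + Σ_{x∈T_ε} ε^dΣ^ε_G(x) = 0"*; r15's `dm2Graph` is its solution): for each of the seven displayed graphs,
−δm²_G + Σ_{x′∈T_ε} ε^dΣ^ε_G(x, x′) = 0. [cite: Balaban1983Higgs3, (1.23) p.417] -/
theorem solves_123 (dm2 : Site P j → ℝ) (x : Site P j) :
    (-ct1 D x + ∑ x' : Site P j, D.w * sig1 D x x' = 0) ∧ (-ct2 D x + ∑ x' : Site P j, D.w * sig2 D x x' = 0) ∧
    (-ct3 D x + ∑ x' : Site P j, D.w * sig3 D x x' = 0) ∧ (-ct4 D x + ∑ x' : Site P j, D.w * sig4 D x x' = 0) ∧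
    (-ct5 D x + ∑ x' : Site P j, D.w * sig5 D x x' = 0) ∧ (-ct6 D x + ∑ x' : Site P j, D.w * sig6 D x x' = 0) ∧
    (-ct7 D dm2 x + ∑ x' : Site P j, D.w * sig7 D dm2 x x' = 0) := by
  simp only [ct1, ct2, ct3, ct4, ct5, ct6, ct7, dm2Graph, neg_add_cancel, and_self]

/-- The same with the closed forms of ①②③ inserted (ε ≠ 0): the first line of (1.23) as printed.
[cite: Balaban1983Higgs3, (1.23) p.417] -/
theorem dm2_123_eq (hε : D.ε ≠ 0) (x : Site P j) :
    dm2_123 D x = -4 * ((D.N : ℝ) + 2) * D.lam * D.C0 x x + D.e ^ 2 * (P.d : ℝ) * D.C x x * D.q2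
      + (2 * 3 : ℝ) / (Nat.factorial 4 : ℕ) * (P.d : ℝ) * D.e ^ 4 * D.ε ^ 2 * (D.C x x) ^ 2 * D.q2 ^ 2
      + ct4 D x + ct5 D x + ct6 D x + ct7 D (dm2One D) x := by
  rw [dm2_123, ct1_eq D hε, ct2_eq D hε, ct3_eq D hε]

end Eq123

/-! ## §4 The order bookkeeping: «δm²₁ … of the order α + 2β = 2», «δm² … defined by the terms of order ≦ 4» -/

section Orders

variable {P : Params} {j : ℕ} (D : SEData P j) (s : ℝ)

/-- ① is of order λ: weight 2. [cite: Balaban1983Higgs3, (1.23) p.417] -/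
theorem sig1_scale : sig1 (D.scale s) = fun x x' => s ^ 2 * sig1 D x x' := by
  funext x x'; simp only [sig1, SEData.scale_N, SEData.scale_lam, SEData.scale_C0, SEData.scale_w]; ring

/-- ② is of order e²: weight 2. [cite: Balaban1983Higgs3, (1.23) p.417] -/
theorem sig2_scale : sig2 (D.scale s) = fun x x' => s ^ 2 * sig2 D x x' := by
  funext x x'; simp only [sig2, SEData.scale_e, SEData.scale_C, SEData.scale_q2, SEData.scale_w]; ring

/-- ③ is of order e⁴: weight 4. [cite: Balaban1983Higgs3, (1.23) p.417] -/
theorem sig3_scale : sig3 (D.scale s) = fun x x' => s ^ 4 * sig3 D x x' := by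
  funext x x'
  simp only [sig3, SEData.scale_e, SEData.scale_ε, SEData.scale_C, SEData.scale_q2, SEData.scale_w]; ring

/-- ④ is of order e²: weight 2. [cite: Balaban1983Higgs3, (1.23) p.417] -/
theorem sig4_scale : sig4 (D.scale s) = fun x x' => s ^ 2 * sig4 D x x' := by
  funext x x'
  simp only [sig4, SEData.scale_e, SEData.scale_C0, SEData.scale_C, SEData.scale_q2, SEData.scale_c, Finset.mul_sum]
  exact Finset.sum_congr rfl fun μ _ => by ring

/-- ⑤ is of order e⁴: weight 4. [cite: Balaban1983Higgs3, (1.23) p.417] -/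
theorem sig5_scale : sig5 (D.scale s) = fun x x' => s ^ 4 * sig5 D x x' := by
  funext x x'; simp only [sig5, SEData.scale_e, SEData.scale_C0, SEData.scale_C, SEData.scale_q2]; ring

/-- ⑥ is of order λ²: weight 4. [cite: Balaban1983Higgs3, (1.23) p.417] -/
theorem sig6_scale : sig6 (D.scale s) = fun x x' => s ^ 4 * sig6 D x x' := by
  funext x x'; simp only [sig6, SEData.scale_N, SEData.scale_lam, SEData.scale_C0]; ring

/-- ⑦ is of order e² times the order of its inserted counterterm: with a weight-2 insertion (δm²₁), weight 4.
[cite: Balaban1983Higgs3, (1.23) p.417] -/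
theorem sig7_scale (dm2 : Site P j → ℝ) :
    sig7 (D.scale s) (fun y => s ^ 2 * dm2 y) = fun x x' => s ^ 4 * sig7 D dm2 x x' := by
  funext x x'
  simp only [sig7, SEData.scale_e, SEData.scale_C0, SEData.scale_C, SEData.scale_q2, SEData.scale_c, SEData.scale_w,
    Finset.mul_sum]
  exact Finset.sum_congr rfl fun μ _ => Finset.sum_congr rfl fun x'' _ => by ring

/-- ⑦ alone (its inserted counterterm not scaled) picks up the factor s² of its coupling e². [cite: Balaban1983Higgs3, (1.23) p.417] -/
theorem sig7_scale_fixed (dm2 : Site P j → ℝ) : sig7 (D.scale s) dm2 = fun x x' => s ^ 2 * sig7 D dm2 x x' := by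
  funext x x'
  simp only [sig7, SEData.scale_e, SEData.scale_C0, SEData.scale_C, SEData.scale_q2, SEData.scale_c, SEData.scale_w,
    Finset.mul_sum]
  exact Finset.sum_congr rfl fun μ _ => Finset.sum_congr rfl fun x'' _ => by ring

/-- the counterterms ①②④ have weight 2 … [cite: Balaban1983Higgs3, (1.23) p.417] -/
theorem ct124_scale (x : Site P j) :
    ct1 (D.scale s) x = s ^ 2 * ct1 D x ∧ ct2 (D.scale s) x = s ^ 2 * ct2 D x ∧ ct4 (D.scale s) x = s ^ 2 * ct4 D x := by
  refine ⟨?_, ?_, ?_⟩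
  · rw [ct1, ct1, sig1_scale, SEData.scale_w, dm2Graph_const_mul]
  · rw [ct2, ct2, sig2_scale, SEData.scale_w, dm2Graph_const_mul]
  · rw [ct4, ct4, sig4_scale, SEData.scale_w, dm2Graph_const_mul]

/-- … and ③⑤⑥ weight 4. [cite: Balaban1983Higgs3, (1.23) p.417] -/
theorem ct356_scale (x : Site P j) :
    ct3 (D.scale s) x = s ^ 4 * ct3 D x ∧ ct5 (D.scale s) x = s ^ 4 * ct5 D x ∧ ct6 (D.scale s) x = s ^ 4 * ct6 D x := by
  refine ⟨?_, ?_, ?_⟩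
  · rw [ct3, ct3, sig3_scale, SEData.scale_w, dm2Graph_const_mul]
  · rw [ct5, ct5, sig5_scale, SEData.scale_w, dm2Graph_const_mul]
  · rw [ct6, ct6, sig6_scale, SEData.scale_w, dm2Graph_const_mul]

/-- ⑦ with a weight-2 insertion has weight 4. [cite: Balaban1983Higgs3, (1.23) p.417] -/
theorem ct7_scale (dm2 : Site P j → ℝ) (x : Site P j) :
    ct7 (D.scale s) (fun y => s ^ 2 * dm2 y) x = s ^ 4 * ct7 D dm2 x := by
  rw [ct7, ct7, sig7_scale, SEData.scale_w, dm2Graph_const_mul]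

/-- **δm²₁ is homogeneous of weight 2** under (e, λ) ↦ (se, s²λ) — *"of the order α + 2β = 2"*.
[cite: Balaban1983Higgs3, (1.23) p.417] -/
theorem dm2One_scale (x : Site P j) : dm2One (D.scale s) x = s ^ 2 * dm2One D x := by
  obtain ⟨h1, h2, h4⟩ := ct124_scale D s x
  rw [dm2One, dm2One, h1, h2, h4]
  ring

/-- as a function. [cite: Balaban1983Higgs3, (1.23) p.417] -/
theorem dm2One_scale' : dm2One (D.scale s) = fun y => s ^ 2 * dm2One D y :=
  funext (dm2One_scale D s)

/-- **The displayed δm² of (1.23) splits by weight as s²·δm²₁ + s⁴·(③ + ⑤ + ⑥ + ⑦(δm²₁))**: δm²₁ is EXACTLY the part of order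
α + 2β = 2, the rest is of order 4, and nothing of order > 4 is displayed — the bookkeeping of p. 417 (*"δm² will be defined by the
terms of order ≦ 4 … δm²₁ denote a sum of terms δm²_{(α,β)} of the order α + 2β = 2"*). [cite: Balaban1983Higgs3, (1.23) p.417] -/
theorem dm2_123_scale (x : Site P j) :
    dm2_123 (D.scale s) x =
      s ^ 2 * dm2One D x + s ^ 4 * (ct3 D x + ct5 D x + ct6 D x + ct7 D (dm2One D) x) := by
  obtain ⟨h1, h2, h4⟩ := ct124_scale D s x
  obtain ⟨h3, h5, h6⟩ := ct356_scale D s x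
  rw [dm2_123, dm2One_scale', ct7_scale, h1, h2, h3, h4, h5, h6, dm2One]
  ring

/-- the ε-lattice weight-4 part of the displayed δm²: ③ + ⑤ + ⑥ + ⑦(δm²₁) (print letters the weight-2 part δm²₁; the weight-4
part has no printed name). [cite: Balaban1983Higgs3, (1.23) p.417] -/
def dm2Two (x : Site P j) : ℝ := ct3 D x + ct5 D x + ct6 D x + ct7 D (dm2One D) x

/-- the displayed δm² is δm²₁ + its weight-4 part. [cite: Balaban1983Higgs3, (1.23) p.417] -/
theorem dm2_123_eq_add (x : Site P j) : dm2_123 D x = dm2One D x + dm2Two D x := by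
  rw [dm2_123, dm2One, dm2Two]; ring

/-- **The recursion** p. 417, verbatim: *"usually it is defined as a solution of the equation −δm² + Σ_{x∈T_ε} ε^dΣ^ε(x) = 0. This
equation can be solved recursively if δm² and Σ^ε are expanded into power series in e, λ. In our case δm² will be defined by the
terms of order ≦ 4. More exactly we write δm² = Σ_{2≦α+2β≦4} e^αλ^βδm²_{(α,β)} and we insert this into Σ^ε. This gives us an
expansion of Σ^ε in coupling constants and we take a sum of terms of order ≦ 4"* — PROVED on the displayed part, with the order
counted by the weight-(1,2) scaling: inserting the graded ansatz δm²(s) = s²·δm²₁ + s⁴·δm²₂ (δm²₂ = `dm2Two`, the weight-4 part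
of (1.23)) at the vertex (1.7) of the scaled Σ^ε and applying print's rule returns the ansatz EXACTLY through order 4 — the weight-2
output s²·δm²₁ involves no inserted counterterm at all (the only δm²-carrying term ⑦ starts at e²: triangularity), the weight-4
output involves only δm²₁ — and the sole discrepancy is the order-6 term s⁶·⑦(δm²₂), beyond print's truncation.
[cite: Balaban1983Higgs3, (1.23) p.417] -/
theorem recursion_order_four (x : Site P j) :
    dm2Graph (D.scale s).w (sigma122 (D.scale s) (fun y => s ^ 2 * dm2One D y + s ^ 4 * dm2Two D y)) x =
      s ^ 2 * dm2One D x + s ^ 4 * dm2Two D x + s ^ 6 * ct7 D (dm2Two D) x := by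
  have h7 : dm2Graph D.w (sig7 (D.scale s) (fun y => s ^ 2 * dm2One D y + s ^ 4 * dm2Two D y)) x =
      s ^ 4 * ct7 D (dm2One D) x + s ^ 6 * ct7 D (dm2Two D) x := by
    have hsplit : (fun y => s ^ 2 * dm2One D y + s ^ 4 * dm2Two D y) =
        (fun y => s ^ 2 * dm2One D y) + fun y => s ^ 4 * dm2Two D y := rfl
    rw [sig7_scale_fixed, dm2Graph_const_mul, hsplit, sig7_add, dm2Graph_add, sig7_const_mul, sig7_const_mul,
      dm2Graph_const_mul, dm2Graph_const_mul, ct7, ct7]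
    ring
  rw [sigma122]
  simp only [dm2Graph_add]
  rw [sig1_scale, sig2_scale, sig3_scale, sig4_scale, sig5_scale, sig6_scale, SEData.scale_w]
  simp only [dm2Graph_const_mul]
  rw [h7]
  simp only [dm2One, dm2Two, ct1, ct2, ct3, ct4, ct5, ct6, ct7]
  ring

/-- **The truncation behind the last term of (1.23)**, at the level of r15's coefficients δm²_{(α,β)} (`idx123` = the orders
2 ≦ α + 2β ≦ 4 of δm²): inserting δm² = Σ e^αλ^βδm²_{(α,β)} at the vertex (1.7) of the e²-graph ⑦ and keeping the terms of
total order ≦ 4 keeps exactly (α,β) ∈ {(2,0), (0,1)}, i.e. the terms of order α + 2β = 2 — δm² ↦ δm²₁.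
[cite: Balaban1983Higgs3, (1.23) p.417] -/
theorem idx123_filter_le_two : idx123.filter (fun ab => ab.1 + 2 + 2 * ab.2 ≤ 4) = {(2, 0), (0, 1)} := by
  decide

/-- hence e²·Σ_{2≦α+2β≦4, α+2+2β≦4} e^αλ^βδm²_{(α,β)} = e²·(e²δm²_{(2,0)} + λδm²_{(0,1)}) = e²·δm²₁ (coefficient form).
[cite: Balaban1983Higgs3, (1.23) p.417] -/
theorem truncation_last_term {X : Type*} [Fintype X] (e lam epsd : ℝ) (SigmaCoeff : ℕ → ℕ → X → ℝ) :
    ∑ ab ∈ idx123.filter (fun ab => ab.1 + 2 + 2 * ab.2 ≤ 4),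
        e ^ 2 * (e ^ ab.1 * lam ^ ab.2 * dm2Coeff epsd SigmaCoeff ab.1 ab.2) =
      e ^ 2 * (e ^ 2 * dm2Coeff epsd SigmaCoeff 2 0 + lam * dm2Coeff epsd SigmaCoeff 0 1) := by
  rw [idx123_filter_le_two, Finset.sum_pair (by decide)]
  ring

/-- the same on r15's `dm2Of123` (δm² = Σ_{2≦α+2β≦4}e^αλ^βδm²_{(α,β)}): e²·δm² = e²·δm²₁ + [the terms of total order > 4].
[cite: Balaban1983Higgs3, (1.23) p.417] -/
theorem truncation_dm2Of123 {X : Type*} [Fintype X] (e lam epsd : ℝ) (SigmaCoeff : ℕ → ℕ → X → ℝ) :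
    e ^ 2 * dm2Of123 e lam epsd SigmaCoeff =
      e ^ 2 * (e ^ 2 * dm2Coeff epsd SigmaCoeff 2 0 + lam * dm2Coeff epsd SigmaCoeff 0 1) +
        ∑ ab ∈ idx123.filter (fun ab => ¬ ab.1 + 2 + 2 * ab.2 ≤ 4),
          e ^ 2 * (e ^ ab.1 * lam ^ ab.2 * dm2Coeff epsd SigmaCoeff ab.1 ab.2) := by
  rw [dm2Of123, Finset.mul_sum, ← truncation_last_term, Finset.sum_filter_add_sum_filter_not]

end Orders

/-! ## §5 The three last pictures ⑦⑧⑨ of (1.23): the last term with δm²₁ split into its three graphs -/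

section LastPictures

variable {P : Params} {j : ℕ} (D : SEData P j)

/-- **(1.23)⑦⑧⑨** p. 417: the last analytic term carries δm²₁ = ① + ② + ④; drawn, it is THREE pictures — the graph ④ (both external
legs at x) with, hung on its φ-line, the φ-tadpole ①, the A-tadpole ②, the graph ④ itself (p18's attached graphs `g123g`, `g123h`,
`g123i`).  PROVED at the level of expressions: ⑦(δm²₁) = ⑦(①) + ⑦(②) + ⑦(④). [cite: Balaban1983Higgs3, (1.23) p.417] -/
theorem ct7_dm2One (x : Site P j) :
    ct7 D (dm2One D) x = ct7 D (ct1 D) x + ct7 D (ct2 D) x + ct7 D (ct4 D) x := by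
  have h : dm2One D = ct1 D + ct2 D + ct4 D := by funext y; simp [dm2One]
  rw [h, ct7_add, ct7_add]

/-- the same at the level of the kernels of (1.22)⑦. [cite: Balaban1983Higgs3, (1.23) p.417] -/
theorem sig7_dm2One : sig7 D (dm2One D) = sig7 D (ct1 D) + sig7 D (ct2 D) + sig7 D (ct4 D) := by
  have h : dm2One D = ct1 D + ct2 D + ct4 D := by funext y; simp [dm2One]
  rw [h, sig7_add, sig7_add]

end LastPictures

/-! ## §6 Translation invariance: print's kernels are functions of x − x′, and the counterterms are numbers -/

section ShiftInvariance

variable {P : Params} {j : ℕ}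

/-- kernel: lattice translations by unit vectors commute. [folklore] -/
private theorem shift_comm' (x : Site P j) (μ ν : Fin P.d) : (x.shift μ).shift ν = (x.shift ν).shift μ := by
  rcases eq_or_ne ν μ with rfl | hne
  · rfl
  funext κ
  unfold Site.shift
  rcases eq_or_ne κ ν with rfl | h1
  · simp only [Function.update_self, Function.update_of_ne hne]
  · rcases eq_or_ne κ μ with rfl | h2
    · simp only [Function.update_self, Function.update_of_ne h1]
    · simp only [Function.update_of_ne h1, Function.update_of_ne h2]

/-- kernel: `x ↦ x + e_μ` is injective. [folklore] -/
private theorem shift_injective' (μ : Fin P.d) : Function.Injective fun x : Site P j => x.shift μ :=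
  (shiftEquiv (P := P) (j := j) μ).injective

/-- A two-point kernel invariant under the simultaneous unit translations of both arguments — print's "(…)(x − x′)"
(a function of the difference; on the torus the unit translations generate all translations). [cite: Balaban1983Higgs3, (1.22) p.416] -/
def ShiftInv (K : Kernel P j) : Prop := ∀ (μ : Fin P.d) (x x' : Site P j), K (x.shift μ) (x'.shift μ) = K x x'

/-- the lattice delta is a function of x − x′. [cite: Balaban1983Higgs3, (1.22) p.416] -/
theorem shiftInv_delta (w : ℝ) : ShiftInv (delta (P := P) (j := j) w) := by
  intro μ x x'
  simp only [delta, (shift_injective' μ).eq_iff]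

/-- the kernel of ∂_μ∘G∘∂*_μ inherits shift invariance. [cite: Balaban1983Higgs3, (1.22) p.416] -/
theorem ShiftInv.dKernel {G : Kernel P j} (hG : ShiftInv G) (c : ℝ) (ν : Fin P.d) : ShiftInv (dKernel c ν G) := by
  intro μ x x'
  simp only [B3Sect3ScalarSelfEnergy.dKernel, shift_comm' x μ ν, shift_comm' x' μ ν]
  rw [hG μ (x.shift ν) (x'.shift ν), hG μ (x.shift ν) x', hG μ x (x'.shift ν), hG μ x x']

/-- the kernel of ∂_μ∘G inherits shift invariance. [cite: Balaban1983Higgs3, (1.22) p.416] -/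
theorem ShiftInv.d1Kernel {G : Kernel P j} (hG : ShiftInv G) (c : ℝ) (ν : Fin P.d) : ShiftInv (d1Kernel c ν G) := by
  intro μ x x'
  simp only [B3Sect3ScalarSelfEnergy.d1Kernel, shift_comm' x μ ν]
  rw [hG μ (x.shift ν) x', hG μ x x']

/-- the kernel of G∘∂*_μ inherits shift invariance. [cite: Balaban1983Higgs3, (1.22) p.416] -/
theorem ShiftInv.dAdjKernel {G : Kernel P j} (hG : ShiftInv G) (c : ℝ) (ν : Fin P.d) : ShiftInv (dAdjKernel c ν G) := by
  intro μ x x'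
  simp only [B3Sect3VectorSelfEnergy.dAdjKernel, shift_comm' x' μ ν]
  rw [hG μ x (x'.shift ν), hG μ x x']

/-- **print's counterterm is a number**: for a shift-invariant kernel, δm²_G(x) = Σ_{x′}ε^dΣ_G(x,x′) does not depend on x (reindex
x′ ↦ x′ + e_μ; then r05's `Site.const_of_shift_invariant`). [cite: Balaban1983Higgs3, (1.23) p.417] -/
theorem dm2Graph_const_of_shiftInv (w : ℝ) {K : Kernel P j} (hK : ShiftInv K) (x y : Site P j) :
    dm2Graph w K x = dm2Graph w K y := by
  refine Site.const_of_shift_invariant (fun z => dm2Graph w K z) (fun μ z => ?_) x y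
  show ∑ x' : Site P j, w * K (z.shift μ) x' = ∑ x' : Site P j, w * K z x'
  rw [← Equiv.sum_comp (shiftEquiv (P := P) (j := j) μ) (fun x' => w * K (z.shift μ) x')]
  exact Finset.sum_congr rfl fun x' _ => by
    show w * K (z.shift μ) (x'.shift μ) = w * K z x'
    rw [hK]

variable (D : SEData P j)

/-- ①②③ are shift invariant when C^ε_0, C^ε are (their diagonal values are then constants). [cite: Balaban1983Higgs3, (1.22) p.416] -/
theorem shiftInv_sig123 (h0 : ShiftInv D.C0) (hC : ShiftInv D.C) :
    ShiftInv (sig1 D) ∧ ShiftInv (sig2 D) ∧ ShiftInv (sig3 D) := by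
  refine ⟨fun μ x x' => ?_, fun μ x x' => ?_, fun μ x x' => ?_⟩
  · simp only [sig1, h0 μ x x, shiftInv_delta D.w μ x x']
  · simp only [sig2, hC μ x x, shiftInv_delta D.w μ x x']
  · simp only [sig3, hC μ x x, shiftInv_delta D.w μ x x']

/-- ④⑤⑥ are shift invariant when C^ε_0, C^ε are. [cite: Balaban1983Higgs3, (1.22) p.416] -/
theorem shiftInv_sig456 (h0 : ShiftInv D.C0) (hC : ShiftInv D.C) :
    ShiftInv (sig4 D) ∧ ShiftInv (sig5 D) ∧ ShiftInv (sig6 D) := by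
  refine ⟨fun μ x x' => ?_, fun μ x x' => ?_, fun μ x x' => ?_⟩
  · simp only [sig4, hC μ x x', (h0.dKernel D.c _) μ x x']
  · simp only [sig5, h0 μ x x', hC μ x x']
  · simp only [sig6, h0 μ x x']

/-- ⑦ is shift invariant when C^ε_0, C^ε are and the inserted counterterm is a constant (reindex the inner sum over x″).
[cite: Balaban1983Higgs3, (1.22) p.416] -/
theorem shiftInv_sig7 (h0 : ShiftInv D.C0) (hC : ShiftInv D.C) (m : ℝ) : ShiftInv (sig7 D fun _ => m) := by
  intro μ x x'
  simp only [sig7, hC μ x x']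
  congr 1
  refine Finset.sum_congr rfl fun ν _ => ?_
  rw [← Equiv.sum_comp (shiftEquiv (P := P) (j := j) μ)
    (fun x'' => D.w * D.q2 * d1Kernel D.c ν D.C0 (x.shift μ) x'' * m * dAdjKernel D.c ν D.C0 x'' (x'.shift μ) * D.C x x')]
  refine Finset.sum_congr rfl fun x'' _ => ?_
  show D.w * D.q2 * d1Kernel D.c ν D.C0 (x.shift μ) (x''.shift μ) * m * dAdjKernel D.c ν D.C0 (x''.shift μ) (x'.shift μ) *
      D.C x x' = _
  rw [(h0.d1Kernel D.c ν) μ x x'', (h0.dAdjKernel D.c ν) μ x'' x']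

/-- **The displayed counterterms ①–⑥ of (1.23) are constants on T_ε** for translation-invariant propagators, as print's
δm²_{(α,β)} are numbers. [cite: Balaban1983Higgs3, (1.23) p.417] -/
theorem ct_const (h0 : ShiftInv D.C0) (hC : ShiftInv D.C) (x y : Site P j) :
    ct1 D x = ct1 D y ∧ ct2 D x = ct2 D y ∧ ct3 D x = ct3 D y ∧ ct4 D x = ct4 D y ∧ ct5 D x = ct5 D y ∧ ct6 D x = ct6 D y := by
  obtain ⟨h1, h2, h3⟩ := shiftInv_sig123 D h0 hC
  obtain ⟨h4, h5, h6⟩ := shiftInv_sig456 D h0 hC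
  exact ⟨dm2Graph_const_of_shiftInv _ h1 x y, dm2Graph_const_of_shiftInv _ h2 x y, dm2Graph_const_of_shiftInv _ h3 x y,
    dm2Graph_const_of_shiftInv _ h4 x y, dm2Graph_const_of_shiftInv _ h5 x y, dm2Graph_const_of_shiftInv _ h6 x y⟩

/-- hence δm²₁ is a constant … [cite: Balaban1983Higgs3, (1.23) p.417] -/
theorem dm2One_const (h0 : ShiftInv D.C0) (hC : ShiftInv D.C) (x y : Site P j) : dm2One D x = dm2One D y := by
  obtain ⟨h1, h2, -, h4, -, -⟩ := ct_const D h0 hC x y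
  rw [dm2One, dm2One, h1, h2, h4]

/-- … and so is the last counterterm ⑦(δm²₁), and the whole displayed δm² of (1.23): *"Thus we have determined the counterterm δm²"*
— a number. [cite: Balaban1983Higgs3, (1.23) p.417] -/
theorem dm2_123_const (h0 : ShiftInv D.C0) (hC : ShiftInv D.C) (x y : Site P j) :
    ct7 D (dm2One D) x = ct7 D (dm2One D) y ∧ dm2_123 D x = dm2_123 D y := by
  have hm : dm2One D = fun _ => dm2One D x := funext fun z => dm2One_const D h0 hC z x
  have h7 : ct7 D (dm2One D) x = ct7 D (dm2One D) y := by
    rw [hm]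
    exact dm2Graph_const_of_shiftInv _ (shiftInv_sig7 D h0 hC _) x y
  obtain ⟨h1, h2, h3, h4, h5, h6⟩ := ct_const D h0 hC x y
  exact ⟨h7, by rw [dm2_123, dm2_123, h1, h2, h3, h4, h5, h6, h7]⟩

end ShiftInvariance

/-! ## §7 The pictures of (1.22) and (1.23) as localized drawn objects -/

section Pictures

open B3Prop1 B3Cor23Concrete B3Sect3LowestOrderGraphs B3Sect3Graphs318 B3Sect1Graphs122 B3Eq37Pictures

variable {nbar : ℕ}

/-- **The counterterm picture of a graph** (p. 417 [PDF 7], verbatim: *"the same graph G but with both external legs localized in x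
and with the summation over x′"*): p18's graph `G` with every EXTERNAL leg localized at the vertex `v` (legs on internal lines stay
at their vertex). [cite: Balaban1983Higgs3, (1.23) p.417] -/
def ctPicture (G : Graph nbar) (v : Fin G.nV) : LocPicture nbar where
  G := G
  loc x := if (G.other x).isSome then x.1 else v
  loc_int x hx := by simp only [hx, if_true]

/-- an external leg of the counterterm picture sits at `v` … [cite: Balaban1983Higgs3, (1.23) p.417] -/
theorem ctPicture_loc_ext (G : Graph nbar) (v : Fin G.nV) (x : Leg G.kind) (hx : G.other x = none) :
    (ctPicture G v).loc x = v := by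
  simp only [ctPicture, hx, Option.isSome_none, Bool.false_eq_true, if_false]

/-- … an internal one at its own vertex. [cite: Balaban1983Higgs3, (1.23) p.417] -/
theorem ctPicture_loc_int (G : Graph nbar) (v : Fin G.nV) (x : Leg G.kind) (hx : (G.other x).isSome) :
    (ctPicture G v).loc x = x.1 :=
  (ctPicture G v).loc_int x hx

/-- **For a ONE-vertex graph the counterterm picture is the graph itself** (every leg is at the only vertex): the pictures ①②③ of
(1.23) are drawn exactly as ①②③ of (1.22). [cite: Balaban1983Higgs3, (1.23) p.417] -/
theorem ctPicture_oneVertex (G : Graph nbar) (hG : G.nV = 1) (v : Fin G.nV) : ctPicture G v = LocPicture.natural G := by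
  have : Subsingleton (Fin G.nV) := by rw [hG]; infer_instance
  unfold ctPicture LocPicture.natural
  congr 1
  funext x
  exact Subsingleton.elim _ _

/-- **The fourth picture of (1.23) IS (3.7)₁'s picture** (this lineage's `pic37a`: p18's `g36a` with both external φ-legs at x = 0).
[cite: Balaban1983Higgs3, (3.7) p.435] -/
theorem ctPicture_g36a (hn : 1 ≤ nbar) : ctPicture (g36a nbar hn) (0 : Fin 2) = pic37a hn := by
  -- the two localization maps agree definitionally (`g36a.other` unfolds to `other36`, `loc37` to the same `if`)
  unfold ctPicture pic37a
  congr 1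

variable (hn : 1 ≤ nbar) (hn2 : 2 ≤ nbar) (hn4 : 4 ≤ nbar)

/-- **(1.22)** p. 416, the seven pictures in printed order, natural localization (each external φ-leg at its own vertex): ① the
φ-tadpole at (1.6) (`g36c`), ② the A-tadpole at (1.10)_{2,0} (`g36b`), ③ two A-tadpoles at (1.10)_{4,0} (`g318b`), ④ = (3.6)₁
(`g36a`), ⑤ two vertices (1.10)_{2,0}, φ-line and both A-lines (`g318a`), ⑥ the sunset (`g318g`), ⑦ = ④ with the vertex (1.7) on its
φ-line (`g122g`). [cite: Balaban1983Higgs3, (1.22) p.416] -/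
def pics122 : List (LocPicture nbar) :=
  [LocPicture.natural (g36c nbar), LocPicture.natural (g36b nbar hn2), LocPicture.natural (g318b nbar hn4),
    LocPicture.natural (g36a nbar hn), LocPicture.natural (g318a nbar hn2), LocPicture.natural (g318g nbar),
    LocPicture.natural (g122g nbar hn)]

/-- **(1.23)** p. 417, the nine pictures in printed order: ①–⑥ the graphs of (1.22) with both external legs localized at x (vertex 0),
⑦⑧⑨ the graph ④ at x with the counterterm of ①, of ②, of ④ hung on its φ-line (p18's attached graphs `g123g`, `g123h`, `g123i`,
external legs at x). [cite: Balaban1983Higgs3, (1.23) p.417] -/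
def pics123 : List (LocPicture nbar) :=
  [ctPicture (g36c nbar) (0 : Fin 1), ctPicture (g36b nbar hn2) (0 : Fin 1), ctPicture (g318b nbar hn4) (0 : Fin 1),
    ctPicture (g36a nbar hn) (0 : Fin 2), ctPicture (g318a nbar hn2) (0 : Fin 2), ctPicture (g318g nbar) (0 : Fin 2),
    ctPicture (g123g nbar hn) (0 : Fin 3), ctPicture (g123h nbar hn2) (0 : Fin 3), ctPicture (g123i nbar hn) (0 : Fin 4)]

/-- seven pictures in (1.22), nine in (1.23). [cite: Balaban1983Higgs3, (1.23) p.417] -/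
theorem pics_length : (pics122 hn hn2 hn4).length = 7 ∧ (pics123 hn hn2 hn4).length = 9 := ⟨rfl, rfl⟩

/-- ①②④ of (1.22) are the pictures (3.6)₃, (3.6)₂, (3.6)₁ of `B3Eq37Pictures` (the same graphs, p. 435 = p. 416 at B̃ = 0, g_k = 1).
[cite: Balaban1983Higgs3, (3.6) p.435] -/
theorem pics122_eq_pic36 :
    (pics122 hn hn2 hn4)[0]? = some pic36c ∧ (pics122 hn hn2 hn4)[1]? = some (pic36b hn2) ∧
      (pics122 hn hn2 hn4)[3]? = some (pic36a hn) := ⟨rfl, rfl, rfl⟩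

/-- ①②③ of (1.23) are drawn as in (1.22) (one vertex); ④ of (1.23) is (3.7)₁'s picture `pic37a`.
[cite: Balaban1983Higgs3, (1.23) p.417] -/
theorem pics123_heads :
    (pics123 hn hn2 hn4)[0]? = some (LocPicture.natural (g36c nbar)) ∧
      (pics123 hn hn2 hn4)[1]? = some (LocPicture.natural (g36b nbar hn2)) ∧
      (pics123 hn hn2 hn4)[2]? = some (LocPicture.natural (g318b nbar hn4)) ∧
      (pics123 hn hn2 hn4)[3]? = some (pic37a hn) := by
  refine ⟨?_, ?_, ?_, ?_⟩
  · exact congrArg some (ctPicture_oneVertex _ rfl _)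
  · exact congrArg some (ctPicture_oneVertex _ rfl _)
  · exact congrArg some (ctPicture_oneVertex _ rfl _)
  · exact congrArg some (ctPicture_g36a hn)

/-- every picture of (1.22)/(1.23) is one of p18's graphs of record (the drawn graph underlying each localized picture).
[cite: Balaban1983Higgs3, (1.23) p.417] -/
theorem pics_graphs :
    (pics122 hn hn2 hn4).map LocPicture.G =
      [g36c nbar, g36b nbar hn2, g318b nbar hn4, g36a nbar hn, g318a nbar hn2, g318g nbar, g122g nbar hn] ∧
    (pics123 hn hn2 hn4).map LocPicture.G =
      [g36c nbar, g36b nbar hn2, g318b nbar hn4, g36a nbar hn, g318a nbar hn2, g318g nbar,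
        g123g nbar hn, g123h nbar hn2, g123i nbar hn] := ⟨rfl, rfl⟩

end Pictures

/-! ## §8 Dictionary: the pictures with their printed kernels ARE the displayed expressions -/

section Dictionary

open B3Prop1 B3Cor23Concrete B3Sect3LowestOrderGraphs B3Sect3Graphs318 B3Sect1Graphs122 B3Eq37Pictures

variable {nbar : ℕ} {P : Params} {j : ℕ} {W : Type*} [NormedAddCommGroup W] [InnerProductSpace ℝ W]
variable (D : SEData P j) (Q : W →ₗ[ℝ] W)

/-- kernel: a sum over the positions of two vertices is a double sum. [folklore] -/
private theorem sum_arrow_fin_two {α M : Type*} [Fintype α] [AddCommMonoid M] (f : (Fin 2 → α) → M) :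
    ∑ xs : Fin 2 → α, f xs = ∑ a : α, ∑ b : α, f ![a, b] := by
  rw [← (finTwoArrowEquiv α).symm.sum_comp f, Fintype.sum_prod_type]
  rfl

/-- kernel: a sum over the positions of three vertices is a triple sum. [folklore] -/
private theorem sum_arrow_fin_three {α M : Type*} [Fintype α] [AddCommMonoid M] (f : (Fin 3 → α) → M) :
    ∑ xs : Fin 3 → α, f xs = ∑ a : α, ∑ b : α, ∑ c : α, f ![a, b, c] := by
  rw [← (Fin.consEquiv (fun _ : Fin 3 => α)).sum_comp f, Fintype.sum_prod_type]
  refine Finset.sum_congr rfl fun a _ => ?_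
  rw [sum_arrow_fin_two]
  rfl

variable (hn : 1 ≤ nbar)

/-- **(1.22)④ ↦ its term**: the natural picture ④ (= `pic36a`) with the kernel Σ₄(x,x′)·Q on its two vertices (Q = the
internal-index structure, any linear map; the real kernel `sig4` carries print's factors) and test fields φ, φ′ on the external
legs is the two-point insertion Σ_{x,x′}ε^{2d}Σ₄(x,x′)⟨φ(x), Qφ′(x′)⟩. [cite: Balaban1983Higgs3, (1.22) p.416] -/
theorem amp_pic122_4 (φ φ' : SiteField P j W) :
    (pic36a hn).amp (sLeg 0 1) (sLeg 1 1) D.ε (kernel2 fun x x' => sig4 D x x' • Q) φ φ' =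
      ∑ x : Site P j, ∑ x' : Site P j, D.ε ^ (2 * P.d) * (sig4 D x x' * ⟪φ x, Q (φ' x')⟫) := by
  rw [amp_pic36a]
  refine Finset.sum_congr rfl fun x _ => Finset.sum_congr rfl fun x' _ => ?_
  rw [LinearMap.smul_apply, real_inner_smul_right]

/-- **(1.23)④ ↦ its counterterm**: the counterterm picture (= `pic37a`, both external legs at x) with the same kernel is the MASS
INSERTION Σ_xε^dct₄(x)⟨φ(x), Qφ′(x)⟩ with ct₄ = Σ_{x′}ε^dΣ₄(x,x′) — *"with the summation over x′"*.
[cite: Balaban1983Higgs3, (1.23) p.417] -/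
theorem amp_pic123_4 (φ φ' : SiteField P j W) :
    (pic37a hn).amp (sLeg 0 1) (sLeg 1 1) D.ε (kernel2 fun x x' => sig4 D x x' • Q) φ φ' =
      ∑ x : Site P j, D.ε ^ P.d * (ct4 D x * ⟪φ x, Q (φ' x)⟫) := by
  rw [amp_pic37a_resummed]
  refine Finset.sum_congr rfl fun x _ => ?_
  have h : (∑ x' : Site P j, D.ε ^ P.d • (sig4 D x x' • Q)) = ct4 D x • Q := by
    rw [ct4, dm2Graph, Finset.sum_smul]
    exact Finset.sum_congr rfl fun x' _ => by rw [smul_smul, SEData.w]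
  rw [h, LinearMap.smul_apply, real_inner_smul_right]

/-- kernel: the resummation Σ_{x,x′}η^{2d}F(x,x′)g(x) = Σ_xη^d(Σ_{x′}η^dF(x,x′))g(x) behind *"with the summation over x′"*.
[cite: Balaban1983Higgs3, (1.23) p.417] -/
private theorem resum_two (η : ℝ) (F : Site P j → Site P j → ℝ) (g : Site P j → ℝ) :
    ∑ x : Site P j, ∑ x' : Site P j, η ^ (2 * P.d) * (F x x' * g x) =
      ∑ x : Site P j, η ^ P.d * ((∑ x' : Site P j, η ^ P.d * F x x') * g x) := by
  refine Finset.sum_congr rfl fun x _ => ?_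
  rw [Finset.sum_mul, Finset.mul_sum]
  refine Finset.sum_congr rfl fun x' _ => ?_
  rw [two_mul, pow_add]
  ring

/-! ### ⑤ and ⑥ (two-vertex graphs `g318a`, `g318g`) -/

variable (hn2 : 2 ≤ nbar)

/-- the external φ-leg (the undifferentiated one, index 1) of the vertex `i` of ⑤ = p18's `g318a`.
[cite: Balaban1983Higgs3, (1.22) p.416] -/
def extLeg5 (i : Fin 2) : Leg (g318a nbar hn2).kind := ⟨i, .inl ⟨1, by simp [g318a, VertexKind.scalarLegs]⟩⟩

/-- the external φ-leg (index 3) of the vertex `i` of the sunset ⑥ = p18's `g318g`. [cite: Balaban1983Higgs3, (1.22) p.416] -/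
def extLeg6 (i : Fin 2) : Leg (g318g nbar).kind := ⟨i, .inl ⟨3, by simp [g318g, VertexKind.scalarLegs]⟩⟩

/-- kernel: these legs of ⑤ are external (no line through them). [cite: Balaban1983Higgs3, (1.22) p.416] -/
theorem extLeg5_other (i : Fin 2) : (g318a nbar hn2).other (extLeg5 hn2 i) = none := by
  fin_cases i <;> rfl

/-- kernel: these legs of ⑥ are external. [cite: Balaban1983Higgs3, (1.22) p.416] -/
theorem extLeg6_other (i : Fin 2) : (g318g nbar).other (extLeg6 (nbar := nbar) i) = none := by
  fin_cases i <;> rfl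

/-- **(1.22)⑤ ↦ its term**: Σ_{x,x′}ε^{2d}Σ₅(x,x′)⟨φ(x), Qφ′(x′)⟩. [cite: Balaban1983Higgs3, (1.22) p.416] -/
theorem amp_pic122_5 (φ φ' : SiteField P j W) :
    (LocPicture.natural (g318a nbar hn2)).amp (extLeg5 hn2 0) (extLeg5 hn2 1) D.ε (kernel2 fun x x' => sig5 D x x' • Q) φ φ' =
      ∑ x : Site P j, ∑ x' : Site P j, D.ε ^ (2 * P.d) * (sig5 D x x' * ⟪φ x, Q (φ' x')⟫) := by
  unfold LocPicture.amp LocPicture.natural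
  show ∑ xs : Fin 2 → Site P j, D.ε ^ (2 * P.d) * ⟪φ (xs 0), kernel2 (fun x x' => sig5 D x x' • Q) xs (φ' (xs 1))⟫ = _
  rw [sum_arrow_fin_two]
  refine Finset.sum_congr rfl fun x _ => Finset.sum_congr rfl fun x' _ => ?_
  simp only [kernel2, Matrix.cons_val_zero, Matrix.cons_val_one, LinearMap.smul_apply, real_inner_smul_right]

/-- **(1.23)⑤ ↦ its counterterm**: Σ_xε^dct₅(x)⟨φ(x), Qφ′(x)⟩. [cite: Balaban1983Higgs3, (1.23) p.417] -/
theorem amp_pic123_5 (φ φ' : SiteField P j W) :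
    (ctPicture (g318a nbar hn2) (0 : Fin 2)).amp (extLeg5 hn2 0) (extLeg5 hn2 1) D.ε
        (kernel2 fun x x' => sig5 D x x' • Q) φ φ' =
      ∑ x : Site P j, D.ε ^ P.d * (ct5 D x * ⟪φ x, Q (φ' x)⟫) := by
  unfold LocPicture.amp
  rw [ctPicture_loc_ext _ _ _ (extLeg5_other hn2 0), ctPicture_loc_ext _ _ _ (extLeg5_other hn2 1)]
  show ∑ xs : Fin 2 → Site P j, D.ε ^ (2 * P.d) * ⟪φ (xs 0), kernel2 (fun x x' => sig5 D x x' • Q) xs (φ' (xs 0))⟫ = _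
  rw [sum_arrow_fin_two]
  simp only [kernel2, Matrix.cons_val_zero, Matrix.cons_val_one, LinearMap.smul_apply, real_inner_smul_right]
  rw [resum_two]
  rfl

/-- **(1.22)⑥ ↦ its term**: Σ_{x,x′}ε^{2d}Σ₆(x,x′)⟨φ(x), Qφ′(x′)⟩. [cite: Balaban1983Higgs3, (1.22) p.416] -/
theorem amp_pic122_6 (φ φ' : SiteField P j W) :
    (LocPicture.natural (g318g nbar)).amp (extLeg6 0) (extLeg6 1) D.ε (kernel2 fun x x' => sig6 D x x' • Q) φ φ' =
      ∑ x : Site P j, ∑ x' : Site P j, D.ε ^ (2 * P.d) * (sig6 D x x' * ⟪φ x, Q (φ' x')⟫) := by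
  unfold LocPicture.amp LocPicture.natural
  show ∑ xs : Fin 2 → Site P j, D.ε ^ (2 * P.d) * ⟪φ (xs 0), kernel2 (fun x x' => sig6 D x x' • Q) xs (φ' (xs 1))⟫ = _
  rw [sum_arrow_fin_two]
  refine Finset.sum_congr rfl fun x _ => Finset.sum_congr rfl fun x' _ => ?_
  simp only [kernel2, Matrix.cons_val_zero, Matrix.cons_val_one, LinearMap.smul_apply, real_inner_smul_right]

/-- **(1.23)⑥ ↦ its counterterm**: Σ_xε^dct₆(x)⟨φ(x), Qφ′(x)⟩. [cite: Balaban1983Higgs3, (1.23) p.417] -/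
theorem amp_pic123_6 (φ φ' : SiteField P j W) :
    (ctPicture (g318g nbar) (0 : Fin 2)).amp (extLeg6 0) (extLeg6 1) D.ε (kernel2 fun x x' => sig6 D x x' • Q) φ φ' =
      ∑ x : Site P j, D.ε ^ P.d * (ct6 D x * ⟪φ x, Q (φ' x)⟫) := by
  unfold LocPicture.amp
  rw [ctPicture_loc_ext _ _ _ (extLeg6_other (nbar := nbar) 0), ctPicture_loc_ext _ _ _ (extLeg6_other (nbar := nbar) 1)]
  show ∑ xs : Fin 2 → Site P j, D.ε ^ (2 * P.d) * ⟪φ (xs 0), kernel2 (fun x x' => sig6 D x x' • Q) xs (φ' (xs 0))⟫ = _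
  rw [sum_arrow_fin_two]
  simp only [kernel2, Matrix.cons_val_zero, Matrix.cons_val_one, LinearMap.smul_apply, real_inner_smul_right]
  rw [resum_two]
  rfl

/-! ### ①②③ (one vertex) -/

/-- **(1.22)/(1.23)①②③ ↦ their terms**: a one-vertex picture (natural = counterterm localization, `ctPicture_oneVertex`) with a
position kernel k(x)·Q gives Σ_xε^dk(x)⟨φ(x), Qφ′(x)⟩ — for ①②③ of (1.23) with k = ct₁, ct₂, ct₃ (the closed forms `ct1_eq` …) this
is the local mass insertion; this lineage's `amp_natural_oneVertex`. [cite: Balaban1983Higgs3, (1.23) p.417] -/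
theorem amp_pic123_oneVertex (G : Graph nbar) (hG : G.nV = 1) (e e' : Leg G.kind) (k : Site P j → ℝ)
    (φ φ' : SiteField P j W) :
    (LocPicture.natural G).amp e e' D.ε (fun xs => k (xs e.1) • Q) φ φ' =
      ∑ xs : Fin G.nV → Site P j, D.ε ^ P.d * (k (xs e.1) * ⟪φ (xs e.1), Q (φ' (xs e.1))⟫) := by
  rw [amp_natural_oneVertex G hG]
  refine Finset.sum_congr rfl fun xs _ => ?_
  rw [LinearMap.smul_apply, real_inner_smul_right]

/-! ### ⑦ (three vertices: x, x′ and the vertex (1.7) at x″) -/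

/-- the integrand of ⑦ at fixed positions (x, x′, x″) of its three vertices:
e²Σ_μ q(∂^ε_μC^ε_0)(x,x″)·δm²(x″)·(C^ε_0∂^{ε*}_μ)(x″,x′)·qC^ε(x,x′). [cite: Balaban1983Higgs3, (1.22) p.416] -/
def k7 (dm2 : Site P j → ℝ) (x x' x'' : Site P j) : ℝ :=
  D.e ^ 2 * ∑ μ : Fin P.d, D.q2 * d1Kernel D.c μ D.C0 x x'' * dm2 x'' * dAdjKernel D.c μ D.C0 x'' x' * D.C x x'

/-- ⑦'s kernel is the sum over the position x″ of the vertex (1.7): Σ₇(x,x′) = Σ_{x″}ε^dk₇(x,x′,x″).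
[cite: Balaban1983Higgs3, (1.22) p.416] -/
theorem sig7_eq_sum_k7 (dm2 : Site P j → ℝ) (x x' : Site P j) :
    sig7 D dm2 x x' = ∑ x'' : Site P j, D.w * k7 D dm2 x x' x'' := by
  simp only [sig7, k7, Finset.mul_sum]
  rw [Finset.sum_comm]
  exact Finset.sum_congr rfl fun x'' _ => Finset.sum_congr rfl fun μ _ => by ring

/-- a three-vertex position kernel. [cite: Balaban1983Higgs3, (1.22) p.416] -/
def kernel3 (k : Site P j → Site P j → Site P j → W →ₗ[ℝ] W) (xs : Fin 3 → Site P j) : W →ₗ[ℝ] W :=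
  k (xs 0) (xs 1) (xs 2)

/-- the two external φ-legs of ⑦ = p18's `g122g` (vertices 0 = x, 1 = x′ of the kind (1.8)_{1,0}; their leg 1 is undifferentiated
and external; vertex 2 = the vertex (1.7) at x″). [cite: Balaban1983Higgs3, (1.22) p.416] -/
def extLeg7 (hn : 1 ≤ nbar) (i : Fin 2) : Leg (g122g nbar hn).kind :=
  ⟨i.castSucc, .inl ⟨1, by fin_cases i <;> simp [g122g, kind122g, VertexKind.scalarLegs]⟩⟩

/-- kernel: these legs are external. [cite: Balaban1983Higgs3, (1.22) p.416] -/
theorem extLeg7_other (i : Fin 2) : (g122g nbar hn).other (extLeg7 hn i) = none := by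
  fin_cases i <;> rfl

/-- **(1.22)⑦ ↦ its term**: the natural three-vertex picture ⑦ with the kernel k₇(x,x′,x″)·Q is
Σ_{x,x′}ε^{2d}Σ₇(x,x′)⟨φ(x), Qφ′(x′)⟩ — the sum over the position x″ of the vertex (1.7) is inside Σ₇ (`sig7_eq_sum_k7`).
[cite: Balaban1983Higgs3, (1.22) p.416] -/
theorem amp_pic122_7 (dm2 : Site P j → ℝ) (φ φ' : SiteField P j W) :
    (LocPicture.natural (g122g nbar hn)).amp (extLeg7 hn 0) (extLeg7 hn 1) D.ε
        (kernel3 fun x x' x'' => k7 D dm2 x x' x'' • Q) φ φ' =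
      ∑ x : Site P j, ∑ x' : Site P j, D.ε ^ (2 * P.d) * (sig7 D dm2 x x' * ⟪φ x, Q (φ' x')⟫) := by
  unfold LocPicture.amp LocPicture.natural
  show ∑ xs : Fin 3 → Site P j,
      D.ε ^ (3 * P.d) * ⟪φ (xs 0), kernel3 (fun x x' x'' => k7 D dm2 x x' x'' • Q) xs (φ' (xs 1))⟫ = _
  rw [sum_arrow_fin_three]
  refine Finset.sum_congr rfl fun x _ => Finset.sum_congr rfl fun x' _ => ?_
  simp only [kernel3, Matrix.cons_val_zero, Matrix.cons_val_one, Matrix.cons_val_two, Matrix.head_cons, Matrix.tail_cons,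
    LinearMap.smul_apply, real_inner_smul_right]
  rw [sig7_eq_sum_k7, Finset.sum_mul, Finset.mul_sum]
  refine Finset.sum_congr rfl fun x'' _ => ?_
  rw [SEData.w, show 3 * P.d = 2 * P.d + P.d by ring, pow_add]
  ring

end Dictionary

end

end Literature.MathematicalPhysics.QuantumFieldTheory.Balaban1983to89.B3Eq123Counterterms
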